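import Literature.Probability.LatticeModels.IsingModel
import HarnessLib

/-!
# Finite-configuration sums for the finite-volume Ising measure: union bounds and the
# Peierls transformation lemma

Topic `Probability/LatticeModels` (any locally finite graph, any boundary condition). The
finite-volume Gibbs measure `μ^{bc}_{Λ;β,h}` is a finite weighted average over the configurations
`τ : Λ → ℤˣ` (Friedli–Velenik 2017, §3.1, Def. 3.1). For combinatorial (Peierls / contour) arguments
it is convenient to work directly with the normalised weight of a finite SET of configurations,
`cfgProb F = (∑_{τ ∈ F} w(τ)) / Z` (`cfgProb`), for which we record

* the bridge to the measure: `μ(T) = cfgProb {τ | glue τ ∈ T}` (`isingMeasure_real_eq_cfgProb`) and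
  `⟨σ_x⟩ = 1 - 2·cfgProb {τ | (glue τ) x = -1}` (`isingExpect_spinAt_eq_one_sub`;
  Friedli–Velenik (3.40): "`⟨σ₀⟩ = 1 - 2μ(σ₀ = -1)`");
* monotonicity and the union bound `cfgProb (⋃ᵢ Fᵢ) ≤ ∑ᵢ cfgProb Fᵢ`;
* **the Peierls transformation lemma** (`cfgProb_le_of_injOn`): if a map `Φ` of configurations is
  injective on `F` and raises the Boltzmann weight by a factor `≥ 1/c` on `F`
  (`w(τ) ≤ c · w(Φ τ)`), then `cfgProb F ≤ c` — the abstract form of "flipping all the spins inside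
  the contour" (Friedli–Velenik 2017, Lemma 3.36 and its proof), with the flip replaced by an
  arbitrary injection (as needed when the two ground states are related by a lattice symmetry
  rather than by the spin flip: Pirogov–Sinai-type models with a symmetry).

Everything is proved; no named facts.

## References

* S. Friedli, Y. Velenik, *Statistical Mechanics of Lattice Systems*, CUP 2017, §3.1 (Def. 3.1,
  eq. (3.8)), §3.7.2 (Lemma 3.36, eq. (3.40)). [FriedliVelenik2017]
-/

noncomputable section

open MeasureTheory Finset

namespace Literature.Probability.LatticeModels

variable {V : Type*} [DecidableEq V] (G : SimpleGraph V) [G.LocallyFinite]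

/-- **The normalised weight of a finite set of configurations**:
`cfgProb F = (∑_{τ ∈ F} w(τ)) / Z`, the `μ^{bc}_{Λ;β,h}`-probability of `{glue τ | τ ∈ F}`.
[cite: FriedliVelenik2017, §3.1, Def. 3.1] -/
def cfgProb (Λ : Finset V) (β h : ℝ) (bc : BoundaryCondition V) (F : Finset (Λ → ℤˣ)) : ℝ :=
  (∑ τ ∈ F, isingWeight G Λ β h bc τ) / isingPartitionFunction G Λ β h bc

variable (Λ : Finset V) (β h : ℝ) (bc : BoundaryCondition V)

/-- Unfolding `cfgProb`. [cite: FriedliVelenik2017, §3.1, Def. 3.1] -/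
theorem cfgProb_def (F : Finset (Λ → ℤˣ)) :
    cfgProb G Λ β h bc F = (∑ τ ∈ F, isingWeight G Λ β h bc τ) / isingPartitionFunction G Λ β h bc := rfl

/-- `cfgProb F ≥ 0`. [cite: FriedliVelenik2017, §3.1] -/
theorem cfgProb_nonneg (F : Finset (Λ → ℤˣ)) : 0 ≤ cfgProb G Λ β h bc F :=
  div_nonneg (sum_nonneg fun τ _ => (isingWeight_pos G Λ β h bc τ).le) (isingPartitionFunction_pos G Λ β h bc).le

/-- `cfgProb` of all configurations is `1`. [cite: FriedliVelenik2017, §3.1] -/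
theorem cfgProb_univ : cfgProb G Λ β h bc univ = 1 := by
  rw [cfgProb, ← isingPartitionFunction, div_self (isingPartitionFunction_pos G Λ β h bc).ne']

/-- `cfgProb` is monotone in the set. [cite: FriedliVelenik2017, §3.1] -/
theorem cfgProb_mono {F F' : Finset (Λ → ℤˣ)} (hFF' : F ⊆ F') : cfgProb G Λ β h bc F ≤ cfgProb G Λ β h bc F' :=
  div_le_div_of_nonneg_right (sum_le_sum_of_subset_of_nonneg hFF' fun τ _ _ => (isingWeight_pos G Λ β h bc τ).le)
    (isingPartitionFunction_pos G Λ β h bc).le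

/-- `cfgProb F ≤ 1`. [cite: FriedliVelenik2017, §3.1] -/
theorem cfgProb_le_one (F : Finset (Λ → ℤˣ)) : cfgProb G Λ β h bc F ≤ 1 := by
  rw [← cfgProb_univ G Λ β h bc]
  exact cfgProb_mono G Λ β h bc (subset_univ F)

/-- `cfgProb` of a union is at most the sum. [cite: FriedliVelenik2017, §3.1] -/
theorem cfgProb_union_le (F F' : Finset (Λ → ℤˣ)) :
    cfgProb G Λ β h bc (F ∪ F') ≤ cfgProb G Λ β h bc F + cfgProb G Λ β h bc F' := by
  rw [cfgProb, cfgProb, cfgProb, ← add_div]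
  refine div_le_div_of_nonneg_right ?_ (isingPartitionFunction_pos G Λ β h bc).le
  rw [← union_sdiff_self_eq_union, sum_union disjoint_sdiff]
  exact add_le_add le_rfl
    (sum_le_sum_of_subset_of_nonneg sdiff_subset fun τ _ _ => (isingWeight_pos G Λ β h bc τ).le)

/-- **Union bound**: `cfgProb (⋃_{i ∈ s} F i) ≤ ∑_{i ∈ s} cfgProb (F i)`. [cite: FriedliVelenik2017, §3.7.2 (union bound over contours)] -/
theorem cfgProb_biUnion_le {ι : Type*} [DecidableEq ι] (s : Finset ι) (F : ι → Finset (Λ → ℤˣ)) :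
    cfgProb G Λ β h bc (s.biUnion F) ≤ ∑ i ∈ s, cfgProb G Λ β h bc (F i) := by
  induction s using Finset.induction_on with
  | empty => simp [cfgProb]
  | insert i s hi ih =>
    rw [biUnion_insert, sum_insert hi]
    exact (cfgProb_union_le G Λ β h bc _ _).trans (add_le_add le_rfl ih)

/-- Union bound for a set contained in an indexed union. [cite: FriedliVelenik2017, §3.7.2] -/
theorem cfgProb_le_sum_of_subset_biUnion {ι : Type*} [DecidableEq ι] (s : Finset ι) (F : ι → Finset (Λ → ℤˣ))
    {E : Finset (Λ → ℤˣ)} (hE : E ⊆ s.biUnion F) :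
    cfgProb G Λ β h bc E ≤ ∑ i ∈ s, cfgProb G Λ β h bc (F i) :=
  (cfgProb_mono G Λ β h bc hE).trans (cfgProb_biUnion_le G Λ β h bc s F)

/-- `cfgProb` of a set all of whose members violate a property that holds everywhere is `0`: the
empty set. [folklore] -/
@[simp] theorem cfgProb_empty : cfgProb G Λ β h bc ∅ = 0 := by simp [cfgProb]

/-- **The Peierls transformation lemma.** If `Φ` is injective on `F` and `w(τ) ≤ c · w(Φ τ)` for
`τ ∈ F`, then `cfgProb F ≤ c`: the transformed weights sum to at most `Z`
(Friedli–Velenik 2017, proof of Lemma 3.36, with the spin flip replaced by an arbitrary injection).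
[cite: FriedliVelenik2017, Lemma 3.36 (proof)] -/
theorem cfgProb_le_of_injOn {F : Finset (Λ → ℤˣ)} {Φ : (Λ → ℤˣ) → (Λ → ℤˣ)} (hinj : Set.InjOn Φ F) {c : ℝ}
    (hc : 0 ≤ c) (hw : ∀ τ ∈ F, isingWeight G Λ β h bc τ ≤ c * isingWeight G Λ β h bc (Φ τ)) :
    cfgProb G Λ β h bc F ≤ c := by
  have hZ := isingPartitionFunction_pos G Λ β h bc
  rw [cfgProb, div_le_iff₀ hZ]
  have hstep : ∑ τ ∈ F, isingWeight G Λ β h bc τ ≤ c * ∑ τ ∈ F, isingWeight G Λ β h bc (Φ τ) := by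
    rw [mul_sum]
    exact sum_le_sum hw
  have himg : ∑ τ ∈ F, isingWeight G Λ β h bc (Φ τ) ≤ isingPartitionFunction G Λ β h bc := by
    rw [← sum_image (f := fun τ => isingWeight G Λ β h bc τ) fun τ hτ τ' hτ' hh => hinj hτ hτ' hh]
    exact sum_le_sum_of_subset_of_nonneg (subset_univ _) fun τ _ _ => (isingWeight_pos G Λ β h bc τ).le
  exact hstep.trans (mul_le_mul_of_nonneg_left himg hc)

/-- **Bridge to the measure**: `μ^{bc}_{Λ;β,h}(T) = cfgProb {τ | glue τ ∈ T}` for measurable `T`.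
[cite: FriedliVelenik2017, §3.1, Def. 3.1] -/
theorem isingMeasure_real_eq_cfgProb {T : Set (SpinConfig V)} (hT : MeasurableSet T) [DecidablePred (· ∈ T)] :
    (isingMeasure G Λ β h bc).real T = cfgProb G Λ β h bc (univ.filter fun τ => glue Λ τ bc ∈ T) := by
  have h0 := cfgProb_nonneg G Λ β h bc (univ.filter fun τ => glue Λ τ bc ∈ T)
  rw [cfgProb] at h0
  rw [measureReal_def, isingMeasure_apply_of_measurableSet G Λ β h bc hT, ENNReal.toReal_ofReal h0]
  rfl

omit [DecidableEq V] in
/-- The one-site event `{σ | σ x = s}` is measurable. [cite: FriedliVelenik2017, §6.2] -/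
theorem measurableSet_apply_eq (x : V) (s : ℤˣ) : MeasurableSet {σ : SpinConfig V | σ x = s} := by
  change MeasurableSet ((fun σ : SpinConfig V => σ x) ⁻¹' {s})
  exact measurable_pi_apply x (measurableSet_singleton s)

/-- **`⟨σ_x⟩ = 1 - 2 μ(σ_x = -1)`** in terms of configuration sums
(Friedli–Velenik 2017, eq. (3.40)). [cite: FriedliVelenik2017, §3.7.2, eq. (3.40)] -/
theorem isingExpect_spinAt_eq_one_sub (x : V) :
    isingExpect G Λ β h bc (spinAt x) =
      1 - 2 * cfgProb G Λ β h bc (univ.filter fun τ => glue Λ τ bc x = -1) := by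
  classical
  have hZ := isingPartitionFunction_pos G Λ β h bc
  rw [isingExpect, integral_isingMeasure G Λ β h bc (measurable_spinAt x), cfgProb, sum_filter]
  have hpt : ∀ τ : Λ → ℤˣ, isingWeight G Λ β h bc τ * spinAt x (glue Λ τ bc) =
      isingWeight G Λ β h bc τ - 2 * (if glue Λ τ bc x = -1 then isingWeight G Λ β h bc τ else 0) := by
    intro τ
    rcases Int.units_eq_one_or (glue Λ τ bc x) with h1 | h1
    · simp [spinAt, h1]
    · simp [spinAt, h1]; ring
  rw [sum_congr rfl fun τ _ => hpt τ, sum_sub_distrib, ← mul_sum, sub_div, ← isingPartitionFunction,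
    div_self hZ.ne', mul_div_assoc]

/-- **Peierls' lower bound on the magnetisation from a bound on `μ(σ_x = -1)`**: if
`cfgProb {σ_x = -1} ≤ ε` then `⟨σ_x⟩ ≥ 1 - 2ε` (Friedli–Velenik 2017, (3.40)).
[cite: FriedliVelenik2017, §3.7.2, eq. (3.40)] -/
theorem one_sub_two_mul_le_isingExpect_spinAt (x : V) {ε : ℝ}
    (hε : cfgProb G Λ β h bc (univ.filter fun τ => glue Λ τ bc x = -1) ≤ ε) :
    1 - 2 * ε ≤ isingExpect G Λ β h bc (spinAt x) := by
  rw [isingExpect_spinAt_eq_one_sub]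
  linarith

end Literature.Probability.LatticeModels

end
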